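import Literature.Analysis.FluidPDE.TimePeriodicNSLatticeSynthesis
import Literature.Analysis.FunctionSpaces.TorusFourierModes
import Literature.Analysis.FunctionSpaces.TorusSobolevNormFacts
import Literature.Analysis.FunctionSpaces.TorusEnstrophyOrthogonality
import Literature.Analysis.FunctionSpaces.TorusClassicalNSGluing
import HarnessLib

/-!
# Time-periodic Navier–Stokes on `T³` in space–time Fourier coefficients, VI: the lattice
# equation of a classical time-periodic orbit (Iooss 1972; Henry 1981, Ch. 8; Kielhöfer 2012, §I.8)

Analysis/FluidPDE proof file (theorems only; no definitions, no named facts), sequel of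
`TimePeriodicNSLatticeSynthesis` on the discharge path of `Literature.Analysis.FluidPDE.PeriodicNSOrbitPersists`.
A classical `τ`-periodic solution `(u, p)` of the forced Navier–Stokes system on `T³ × ℝ` with a
time-independent mean-zero force `f` is read on the space–time torus `T⁴`
(`U = Torus.timeRoll τ u`, `FunctionSpaces/TorusTimePeriodicLift`); this file computes the
space–time Fourier coefficients of every term of the momentum equation and derives the data
used by the lattice files:

* §A coefficient calculus on `T⁴` with frequencies written `Fin.cons n k`: time derivative
  (`2πi n`), spatial derivatives (`2πi kⱼ`), spatial Laplacian (`−4π²|k|²`), spatial gradients of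
  scalars (`(2πi q̂) k`), transported products `∑ⱼ Aⱼ ∂_{j+1} W ↦ N(â, ŵ)` (the space–time
  convective symbol of `TimePeriodicNSLattice`), transversality of divergence-free fields, and
  the vanishing of the Leray multiplier on curl-free (pressure-gradient) fields;
* §B the **rolled-up momentum identity**: from an identity
  `∂₀U = a (νΔₓU − (U·∇ₓ)U − G + F∘tail)` on `T⁴` with `div_x U = 0`, curl-free mean-zero
  slices of `G` and slice means `m₀` of `U`, the family `û(n,k) = 𝓕(U − m₀)(n,k)` vanishes on
  the zero spatial modes, is transversal, conjugate symmetric, rapidly decaying, and solves the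
  **projected lattice equation**
  `(2πi a⁻¹ n + 4π²ν|k|² + 2πi m₀·k) û + Π_k N(û, û) = [n = 0] f̂(k)` (`k ≠ 0`);
* §C the classical `τ`-periodic orbit satisfies the hypotheses of §B with `a = τ`,
  `m₀ = ∫ u(0)` (mean conservation, `∫ f = 0`) and `G` the rolled-up pressure gradient, whence
  the lattice data of the orbit (`orbit_…` theorems).

## References

* G. Iooss, Arch. Rational Mech. Anal. 47 (1972) 301–329, §2. [Iooss1972]
* D. Henry, *Geometric Theory of Semilinear Parabolic Equations*, LNM 840 (1981), Ch. 8. [Henry1981]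
* H. Kielhöfer, *Bifurcation Theory*, 2nd ed. (2012), §I.8 (PDF pp. 59–60). [Kielhofer2012]
-/

noncomputable section

open scoped BigOperators Topology ENNReal NNReal ComplexConjugate
open Filter Set Function MeasureTheory UnitAddTorus

namespace Literature.Analysis.FluidPDE

namespace TimePeriodicLattice

open Literature.Analysis.FunctionSpaces Literature.Analysis.FunctionSpaces.Torus
open Literature.Analysis.FunctionSpaces.EuclideanSpace
open Literature.Analysis.FluidPDE.ScalarFourier

-- BODY START
-- NOTATION START
/-- Local notation: the convective symbol on `ℤ × ℤ³` (as in `TimePeriodicNSLattice`). -/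
local notation:max "𝐍[" a ", " b "]" m:max =>
  (WithLp.toLp 2 (fun p : Fin 3 => ∑ j : Fin 3, ∑' m' : ℤ × (Fin 3 → ℤ),
    a m' j * (dsym j (Prod.snd m - Prod.snd m') * b (m - m') p)) : EuclideanSpace ℂ (Fin 3))

/-- Local notation: the lattice family `(n, k) ↦ C (Fin.cons n k)` of a family `C` on `ℤ⁴`. -/
local notation:max "𝐋" C:max => (fun mm : ℤ × (Fin 3 → ℤ) => C (Fin.cons (Prod.fst mm) (Prod.snd mm) : Fin 4 → ℤ))

/-- Local notation: the lattice family `û(n,k) = 𝓕(complexify ∘ (U − m₀))(n,k)` of a real field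
`U` on `T⁴` with slice means `m₀`. -/
local notation:max "𝐮[" U ", " m₀ "]" => (fun mm : ℤ × (Fin 3 → ℤ) =>
  mFourierCoeff (EuclideanSpace.complexify ∘ fun y : UnitAddTorus (Fin 4) => U y - m₀)
    (Fin.cons (Prod.fst mm) (Prod.snd mm) : Fin 4 → ℤ))

/-- Local notation: the rolled-up pressure-gradient field of a `τ`-periodic classical solution,
*defined* from the momentum equation: `G = ν ΔₓU − (U·∇ₓ)U + f∘tail − τ⁻¹ ∂₀U`, `U = timeRoll τ u`. -/
local notation:max "𝐆[" ν ", " τ ", " f ", " u "]" => (fun y : UnitAddTorus (Fin 4) =>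
  ν • (∑ i : Fin 3, Torus.partialDeriv (Fin.succ i) (Torus.partialDeriv (Fin.succ i) (Torus.timeRoll τ u)) y) -
    (∑ j : Fin 3, ((Torus.timeRoll τ u) y) j • Torus.partialDeriv (Fin.succ j) (Torus.timeRoll τ u) y) +
    f (Fin.tail y) - τ⁻¹ • Torus.partialDeriv 0 (Torus.timeRoll τ u) y)
-- NOTATION END

/-! ## §A⁵ Coefficient calculus on `T⁴` -/

section Calculus

/-- **The Leray multiplier kills vectors parallel to the frequency**: if `kᵢ vⱼ = kⱼ vᵢ` for all
`i, j` and `k ≠ 0` then `Π_k v = 0` (`v = (k·v/|k|²) k`). [folklore] -/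
theorem lerayCoeff_eq_zero_of_symm {k : Fin 3 → ℤ} (hk : k ≠ 0) {v : EuclideanSpace ℂ (Fin 3)}
    (h : ∀ i j : Fin 3, ((k i : ℤ) : ℂ) * v j = ((k j : ℤ) : ℂ) * v i) : Torus.lerayCoeff k v = 0 := by
  have hf : ((freqNormSq k : ℝ) : ℂ) ≠ 0 := by
    exact_mod_cast ne_of_gt (lt_of_lt_of_le one_pos (Torus.one_le_freqNormSq hk))
  have hv : v = ((∑ jj : Fin 3, ((k jj : ℤ) : ℂ) * v jj) / ((freqNormSq k : ℝ) : ℂ)) • Torus.freqVec k := by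
    ext j
    rw [PiLp.smul_apply, Torus.freqVec_apply, smul_eq_mul, eq_comm, div_mul_eq_mul_div, div_eq_iff hf]
    have e : ((freqNormSq k : ℝ) : ℂ) = ∑ jj : Fin 3, ((k jj : ℤ) : ℂ) * ((k jj : ℤ) : ℂ) := by
      simp only [freqNormSq, Complex.ofReal_sum, Complex.ofReal_pow, Complex.ofReal_intCast]
      exact Finset.sum_congr rfl fun jj _ => by ring
    rw [e, Finset.sum_mul, Finset.mul_sum]
    refine Finset.sum_congr rfl fun jj _ => ?_
    calc ((k jj : ℤ) : ℂ) * v jj * ((k j : ℤ) : ℂ) = ((k jj : ℤ) : ℂ) * (((k j : ℤ) : ℂ) * v jj) := by ring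
      _ = ((k jj : ℤ) : ℂ) * (((k jj : ℤ) : ℂ) * v j) := by rw [← h jj j]
      _ = v j * (((k jj : ℤ) : ℂ) * ((k jj : ℤ) : ℂ)) := by ring
  rw [hv, SteadyLattice.lerayCoeff_smul', SteadyLattice.lerayCoeff_freqVec, smul_zero]

variable {W : UnitAddTorus (Fin 4) → EuclideanSpace ℂ (Fin 3)}

/-- Components of smooth `ℂ³`-valued functions are smooth. [folklore] -/
theorem isSmooth_apply (hW : IsSmooth W) (i : Fin 3) : IsSmooth (fun y => (W y) i) :=
  hW.comp_clm ((EuclideanSpace.proj i : EuclideanSpace ℂ (Fin 3) →L[ℂ] ℂ).restrictScalars ℝ)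

/-- Components of partial derivatives: `(∂ⱼ W y)ᵢ = ∂ⱼ (Wᵢ) y`. [folklore] -/
theorem partialDeriv_apply (hW : IsSmooth W) (j : Fin 4) (i : Fin 3) (y : UnitAddTorus (Fin 4)) :
    (Torus.partialDeriv j W y) i = Torus.partialDeriv j (fun z => (W z) i) y :=
  (partialDeriv_clm_comp hW ((EuclideanSpace.proj i : EuclideanSpace ℂ (Fin 3) →L[ℂ] ℂ).restrictScalars ℝ) j y).symm

/-- Coefficients of components: `𝓕(Wᵢ)(K) = 𝓕W(K)ᵢ` for smooth `W`. [folklore] -/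
theorem mFourierCoeff_apply' (hW : IsSmooth W) (K : Fin 4 → ℤ) (i : Fin 3) :
    mFourierCoeff (fun y => (W y) i) K = (mFourierCoeff W K) i :=
  (mFourierCoeff_apply_euclidean hW.integrable K i).symm


/-- Coefficients of the complexified components of a real field: `𝓕(Uⱼ)(K) = 𝓕(complexify ∘ U)(K)ⱼ`. [folklore] -/
theorem mFourierCoeff_ofReal_apply {U : UnitAddTorus (Fin 4) → EuclideanSpace ℝ (Fin 3)} (hU : IsSmooth U)
    (K : Fin 4 → ℤ) (jj : Fin 3) :
    mFourierCoeff (fun y => (((U y) jj : ℝ) : ℂ)) K = (mFourierCoeff (complexify ∘ U) K) jj := by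
  have hUc : IsSmooth (complexify ∘ U) := hU.comp_clm complexify.toContinuousLinearMap
  rw [mFourierCoeff_apply_euclidean hUc.integrable]
  rfl

/-- Partial derivatives of the complexified components of a real field. [folklore] -/
theorem partialDeriv_ofReal_apply {U : UnitAddTorus (Fin 4) → EuclideanSpace ℝ (Fin 3)} (hU : IsSmooth U)
    (j : Fin 4) (i : Fin 3) (y : UnitAddTorus (Fin 4)) :
    Torus.partialDeriv j (fun z => (((U z) i : ℝ) : ℂ)) y = ((Torus.partialDeriv j (fun z => (U z) i) y : ℝ) : ℂ) :=
  partialDeriv_clm_comp (hU.comp_clm (EuclideanSpace.proj i : EuclideanSpace ℝ (Fin 3) →L[ℝ] ℝ)) Complex.ofRealCLM j y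

/-- Smoothness of the complexified components of a real field. [folklore] -/
theorem isSmooth_ofReal_apply {U : UnitAddTorus (Fin 4) → EuclideanSpace ℝ (Fin 3)} (hU : IsSmooth U) (i : Fin 3) :
    IsSmooth (fun z => (((U z) i : ℝ) : ℂ)) :=
  (hU.comp_clm (EuclideanSpace.proj i : EuclideanSpace ℝ (Fin 3) →L[ℝ] ℝ)).comp_clm Complex.ofRealCLM

/-- **Time derivative**: `𝓕(∂₀W)(n,k) = (2πi n) 𝓕W(n,k)`. [folklore] -/
theorem mFourierCoeff_partialDeriv_zero_cons (hW : IsSmooth W) (n : ℤ) (k : Fin 3 → ℤ) :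
    mFourierCoeff (Torus.partialDeriv 0 W) (Fin.cons n k) =
      (2 * Real.pi * Complex.I * (n : ℂ)) • mFourierCoeff W (Fin.cons n k) := by
  rw [mFourierCoeff_partialDeriv hW 0 (Fin.cons n k), Fin.cons_zero]

/-- **Spatial derivatives**: `𝓕(∂_{j+1}W)(n,k) = (2πi kⱼ) 𝓕W(n,k)`. [folklore] -/
theorem mFourierCoeff_partialDeriv_succ_cons (hW : IsSmooth W) (j : Fin 3) (n : ℤ) (k : Fin 3 → ℤ) :
    mFourierCoeff (Torus.partialDeriv (Fin.succ j) W) (Fin.cons n k) = dsym j k • mFourierCoeff W (Fin.cons n k) := by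
  rw [mFourierCoeff_partialDeriv hW (Fin.succ j) (Fin.cons n k), Fin.cons_succ, dsym_apply]

/-- **Spatial Laplacian**: `𝓕(∑ᵢ ∂_{i+1}∂_{i+1}W)(n,k) = −4π²|k|² 𝓕W(n,k)`. [folklore] -/
theorem mFourierCoeff_laplacianX_cons (hW : IsSmooth W) (n : ℤ) (k : Fin 3 → ℤ) :
    mFourierCoeff (fun y => ∑ i : Fin 3, Torus.partialDeriv (Fin.succ i) (Torus.partialDeriv (Fin.succ i) W) y) (Fin.cons n k) =
      (((-(4 * Real.pi ^ 2 * freqNormSq k) : ℝ)) : ℂ) • mFourierCoeff W (Fin.cons n k) := by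
  rw [mFourierCoeff_finset_sum Finset.univ (fun i _ => ((hW.partialDeriv _).partialDeriv _).integrable)]
  simp_rw [mFourierCoeff_partialDeriv_succ_cons (hW.partialDeriv _), mFourierCoeff_partialDeriv_succ_cons hW,
    smul_smul, ← Finset.sum_smul]
  congr 1
  simp only [dsym_apply, freqNormSq]
  push_cast
  rw [Finset.mul_sum, ← Finset.sum_neg_distrib]
  refine Finset.sum_congr rfl fun i _ => ?_
  linear_combination (4 * (Real.pi : ℂ) ^ 2 * ((k i : ℤ) : ℂ) ^ 2) * Complex.I_mul_I

/-- **Spatial gradient of a scalar**: `𝓕(∇ₓQ)(n,k) = (2πi 𝓕Q(n,k)) k`. [folklore] -/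
theorem mFourierCoeff_gradX_cons {Q : UnitAddTorus (Fin 4) → ℂ} (hQ : IsSmooth Q) (n : ℤ) (k : Fin 3 → ℤ) :
    mFourierCoeff (fun y => (WithLp.toLp 2 (fun i : Fin 3 => Torus.partialDeriv (Fin.succ i) Q y) : EuclideanSpace ℂ (Fin 3)))
        (Fin.cons n k) =
      (2 * Real.pi * Complex.I * mFourierCoeff Q (Fin.cons n k)) • Torus.freqVec k := by
  have hc : Continuous (fun y => (WithLp.toLp 2 (fun i : Fin 3 => Torus.partialDeriv (Fin.succ i) Q y) : EuclideanSpace ℂ (Fin 3))) := by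
    refine (PiLp.continuous_toLp 2 _).comp ?_   -- hmm
    exact continuous_pi fun i => (hQ.partialDeriv _).continuous
  ext i
  rw [mFourierCoeff_apply_euclidean hc.integrable_unitAddTorus]
  simp only [PiLp.smul_apply, Torus.freqVec_apply, smul_eq_mul]
  rw [mFourierCoeff_partialDeriv hQ (Fin.succ i) (Fin.cons n k), Fin.cons_succ, smul_eq_mul]
  ring

/-- **Transported products**: for smooth `ℂ³`-valued `A`, `W` on `T⁴`,
`𝓕(∑ⱼ Aⱼ ∂_{j+1} W)(n,k) = N(â, ŵ)(n,k)` with the space–time convective symbol `N` of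
`TimePeriodicNSLattice` and the lattice families `â = 𝓕A ∘ cons`, `ŵ = 𝓕W ∘ cons`
(`ScalarFourier.mFourierCoeff_mul`: products become convolutions on `ℤ⁴ ≅ ℤ × ℤ³`). [folklore] -/
theorem mFourierCoeff_transport_cons {A : UnitAddTorus (Fin 4) → EuclideanSpace ℂ (Fin 3)} (hA : IsSmooth A)
    (hW : IsSmooth W) (n : ℤ) (k : Fin 3 → ℤ) :
    mFourierCoeff (fun y => ∑ j : Fin 3, (A y) j • Torus.partialDeriv (Fin.succ j) W y) (Fin.cons n k) =
      𝐍[𝐋 (mFourierCoeff A), 𝐋 (mFourierCoeff W)] (n, k) := by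
  have hAj : ∀ j, IsSmooth (fun y => (A y) j) := isSmooth_apply hA
  have hWi : ∀ i, IsSmooth (fun y => (W y) i) := isSmooth_apply hW
  have hT : Continuous (fun y => ∑ j : Fin 3, (A y) j • Torus.partialDeriv (Fin.succ j) W y) :=
    continuous_finsetSum _ fun j _ => (hAj j).continuous.smul (hW.partialDeriv _).continuous
  ext i
  rw [mFourierCoeff_apply_euclidean hT.integrable_unitAddTorus]
  refine Eq.trans ?_ (nl_apply (𝐋 (mFourierCoeff A)) (𝐋 (mFourierCoeff W)) (n, k) i).symm
  have hfun : (fun y => (∑ j : Fin 3, (A y) j • Torus.partialDeriv (Fin.succ j) W y) i) =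
      fun y => ∑ j : Fin 3, (fun z => (A z) j) y * Torus.partialDeriv (Fin.succ j) (fun z => (W z) i) y := by
    funext y
    rw [WithLp.ofLp_sum, Finset.sum_apply]
    refine Finset.sum_congr rfl fun j _ => ?_
    rw [WithLp.ofLp_smul, Pi.smul_apply, smul_eq_mul, ← partialDeriv_apply hW]
  have hint : ∀ j : Fin 3,
      Integrable (fun y => (fun z => (A z) j) y * Torus.partialDeriv (Fin.succ j) (fun z => (W z) i) y) volume :=
    fun j => ((hAj j).continuous.mul ((hWi i).partialDeriv (Fin.succ j)).continuous).integrable_unitAddTorus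
  rw [hfun, mFourierCoeff_finset_sum Finset.univ (fun j _ => hint j)]
  refine Finset.sum_congr rfl fun j _ => ?_
  rw [ScalarFourier.mFourierCoeff_mul (hAj j).continuous (hAj j).rapidDecay_mFourierCoeff.summable_norm
    ((hWi i).partialDeriv _).continuous, lconv_apply, tsum_eq_tsum_cons]
  refine tsum_congr fun m' => ?_
  rw [cons_sub_cons, mFourierCoeff_partialDeriv (hWi i) (Fin.succ j) _, Fin.cons_succ,
    mFourierCoeff_apply' hA, mFourierCoeff_apply' hW, dsym_apply, smul_eq_mul]
  rfl

/-- **Divergence-free fields have transversal coefficients**: if `∑ᵢ ∂_{i+1} Uᵢ = 0` on `T⁴`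
(real `U`) then `k · 𝓕U(n,k) = 0`. [folklore] -/
theorem kdot_mFourierCoeff_eq_zero_of_divFree {U : UnitAddTorus (Fin 4) → EuclideanSpace ℝ (Fin 3)} (hU : IsSmooth U)
    (hdiv : ∀ y, ∑ i : Fin 3, Torus.partialDeriv (Fin.succ i) (fun z => U z i) y = 0) (n : ℤ) (k : Fin 3 → ℤ) :
    (∑ jj : Fin 3, ((k jj : ℤ) : ℂ) * (mFourierCoeff (complexify ∘ U) (Fin.cons n k)) jj) = 0 := by
  have hUi : ∀ i, IsSmooth (fun y => (((U y) i : ℝ) : ℂ)) := isSmooth_ofReal_apply hU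
  -- the complexified divergence vanishes, hence so do its coefficients
  set D : UnitAddTorus (Fin 4) → ℂ := fun y => ∑ i : Fin 3, Torus.partialDeriv (Fin.succ i) (fun z => (((U z) i : ℝ) : ℂ)) y
    with hD
  have hD0 : D = 0 := by
    funext y
    simp only [hD, Pi.zero_apply]
    simp_rw [partialDeriv_ofReal_apply hU, ← Complex.ofReal_sum, hdiv y, Complex.ofReal_zero]
  have hcoef : mFourierCoeff D (Fin.cons n k) = 0 := by rw [hD0]; simp [mFourierCoeff]
  rw [hD, mFourierCoeff_finset_sum Finset.univ (fun i _ => ((hUi i).partialDeriv _).integrable)] at hcoef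
  simp_rw [mFourierCoeff_partialDeriv (hUi _) (Fin.succ _) (Fin.cons n k), Fin.cons_succ, smul_eq_mul,
    mFourierCoeff_ofReal_apply hU] at hcoef
  have h2 : (2 * Real.pi * Complex.I : ℂ) ≠ 0 := by simp [Real.pi_ne_zero]
  have : (2 * Real.pi * Complex.I) *
      (∑ jj : Fin 3, ((k jj : ℤ) : ℂ) * (mFourierCoeff (complexify ∘ U) (Fin.cons n k)) jj) = 0 := by
    rw [Finset.mul_sum, ← hcoef]
    refine Finset.sum_congr rfl fun jj _ => ?_
    ring
  exact (mul_eq_zero.1 this).resolve_left h2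

/-- **The Leray multiplier kills curl-free fields**: if the real field `G` on `T⁴` has
`∂_{i+1}Gⱼ = ∂_{j+1}Gᵢ` (its slices are gradients), then `Π_k 𝓕G(n,k) = 0` for `k ≠ 0`. [folklore] -/
theorem lerayCoeff_mFourierCoeff_eq_zero_of_curlFree {G : UnitAddTorus (Fin 4) → EuclideanSpace ℝ (Fin 3)} (hG : IsSmooth G)
    (hcurl : ∀ y (i j : Fin 3), Torus.partialDeriv (Fin.succ i) (fun z => G z j) y =
      Torus.partialDeriv (Fin.succ j) (fun z => G z i) y)
    (n : ℤ) {k : Fin 3 → ℤ} (hk : k ≠ 0) :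
    Torus.lerayCoeff k (mFourierCoeff (complexify ∘ G) (Fin.cons n k)) = 0 := by
  have hGi : ∀ i, IsSmooth (fun y => (((G y) i : ℝ) : ℂ)) := isSmooth_ofReal_apply hG
  refine lerayCoeff_eq_zero_of_symm hk fun i j => ?_
  have hfun : Torus.partialDeriv (Fin.succ i) (fun z => (((G z) j : ℝ) : ℂ)) =
      Torus.partialDeriv (Fin.succ j) (fun z => (((G z) i : ℝ) : ℂ)) := by
    funext y
    rw [partialDeriv_ofReal_apply hG, partialDeriv_ofReal_apply hG, hcurl y i j]
  have hcoef := congrArg (fun g : UnitAddTorus (Fin 4) → ℂ => mFourierCoeff g (Fin.cons n k)) hfun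
  simp only at hcoef
  rw [mFourierCoeff_partialDeriv (hGi j), mFourierCoeff_partialDeriv (hGi i), Fin.cons_succ, Fin.cons_succ,
    mFourierCoeff_ofReal_apply hG, mFourierCoeff_ofReal_apply hG, smul_eq_mul, smul_eq_mul] at hcoef
  have h2 : (2 * Real.pi * Complex.I : ℂ) ≠ 0 := by simp [Real.pi_ne_zero]
  have : (2 * Real.pi * Complex.I) * (((k i : ℤ) : ℂ) * (mFourierCoeff (complexify ∘ G) (Fin.cons n k)) j) =
      (2 * Real.pi * Complex.I) * (((k j : ℤ) : ℂ) * (mFourierCoeff (complexify ∘ G) (Fin.cons n k)) i) := by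
    linear_combination hcoef
  exact mul_left_cancel₀ h2 this

/-- `∫_{T³} ∇θ = 0` for smooth `θ` (each `∫ ∂ᵢθ = 0`). [folklore] -/
theorem integral_gradient_eq_zero' {θ : UnitAddTorus (Fin 3) → ℝ} (hθ : IsSmooth θ) : ∫ y, Torus.gradient θ y = 0 := by
  simp_rw [gradient_eq_sum_partialDeriv (hθ.isContDiff (by simp))]
  rw [integral_finsetSum _ fun i _ => ((hθ.partialDeriv i).integrable.smul_const _)]
  refine Finset.sum_eq_zero fun i _ => ?_
  rw [integral_smul_const, integral_partialDeriv_eq_zero_holds hθ i, zero_smul]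

/-- `(∇θ x)ⱼ = ∂ⱼθ x` for `C¹` scalar `θ`. [folklore] -/
theorem gradient_apply_eq' {θ : UnitAddTorus (Fin 3) → ℝ} (hθ : IsContDiff 1 θ) (x : UnitAddTorus (Fin 3)) (j : Fin 3) :
    Torus.gradient θ x j = Torus.partialDeriv j θ x := by
  have h := inner_gradient_eq_sum_mul_partialDeriv hθ (EuclideanSpace.single j (1 : ℝ)) x
  rw [EuclideanSpace.inner_single_left, map_one, one_mul] at h
  rw [h, Finset.sum_eq_single j (fun i _ hij => by simp [hij]) (by simp)]
  simp

/-- Partial derivatives ignore additive constants. [folklore] -/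
theorem partialDeriv_sub_const {F : Type*} [NormedAddCommGroup F] [NormedSpace ℝ F] {d : Type*} [Fintype d] [DecidableEq d]
    (g : UnitAddTorus d → F) (c : F) (j : d) (x : UnitAddTorus d) :
    Torus.partialDeriv j (fun y => g y - c) x = Torus.partialDeriv j g x := by
  simp only [Torus.partialDeriv, Torus.lineDeriv, deriv_sub_const]

end Calculus

/-! ## §B⁵ From the rolled-up momentum identity to the projected lattice equation -/

section RolledUp

variable {U G : UnitAddTorus (Fin 4) → EuclideanSpace ℝ (Fin 3)} {F : UnitAddTorus (Fin 3) → EuclideanSpace ℝ (Fin 3)}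
  {m₀ : EuclideanSpace ℝ (Fin 3)} {a ν : ℝ}

/-- **Zero spatial modes**: if every slice of `U` has mean `m₀`, the coefficients of `U − m₀`
vanish on `(n, 0)`. [folklore] -/
theorem coeff_sub_mean_cons_zero (hU : IsSmooth U) (hMean : ∀ c : UnitAddCircle, ∫ x, timeSlice U c x = m₀) (n : ℤ) :
    mFourierCoeff (complexify ∘ fun y => U y - m₀) (Fin.cons n 0) = 0 := by
  have hVc : IsSmooth (complexify ∘ fun y => U y - m₀) :=
    (hU.sub (isSmooth_const m₀)).comp_clm complexify.toContinuousLinearMap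
  have hint : ∀ c : UnitAddCircle, ∫ x, timeSlice (complexify ∘ fun y => U y - m₀) c x = 0 := by
    intro c
    have h1 : (timeSlice (complexify ∘ fun y => U y - m₀) c) =
        fun x => complexify.toContinuousLinearMap ((fun x => timeSlice U c x - m₀) x) := by
      funext x; simp
    have hint2 : Integrable (fun x => timeSlice U c x - m₀) volume := ((hU.timeSlice c).sub (isSmooth_const m₀)).integrable
    rw [h1, ContinuousLinearMap.integral_comp_comm _ hint2]
    have h2 : (∫ x, (fun x => timeSlice U c x - m₀) x) = 0 := by
      simp only
      rw [integral_sub (hU.timeSlice c).integrable (integrable_const m₀), hMean c, integral_const, probReal_univ,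
        one_smul, sub_self]
    rw [h2, map_zero]
  have h := mFourierCoeff_cons_zero_of_integral_timeSlice _ hVc.continuous (M := 0) hint n
  simpa using h

/-- **Transversality** of the coefficients of `U − m₀` for divergence-free `U`. [folklore] -/
theorem kdot_coeff_sub_mean (hU : IsSmooth U)
    (hdiv : ∀ y, ∑ i : Fin 3, Torus.partialDeriv (Fin.succ i) (fun z => U z i) y = 0) (m : ℤ × (Fin 3 → ℤ)) :
    (∑ jj : Fin 3, ((m.2 jj : ℤ) : ℂ) * (mFourierCoeff (complexify ∘ fun y => U y - m₀) (Fin.cons m.1 m.2)) jj) = 0 := by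
  have hV : IsSmooth (fun y => U y - m₀) := hU.sub (isSmooth_const m₀)
  refine kdot_mFourierCoeff_eq_zero_of_divFree hV (fun y => ?_) m.1 m.2
  rw [← hdiv y]
  refine Finset.sum_congr rfl fun i _ => ?_
  have : (fun z => (U z - m₀) i) = fun z => (fun w => U w i) z - m₀ i := by funext z; simp
  rw [this, partialDeriv_sub_const]

/-- **Conjugate symmetry** of the coefficients of the real field `U − m₀`. [folklore] -/
theorem coeff_sub_mean_neg (hU : IsSmooth U) (m : ℤ × (Fin 3 → ℤ)) :
    mFourierCoeff (complexify ∘ fun y => U y - m₀) (Fin.cons (-m).1 (-m).2) =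
      conjVec (mFourierCoeff (complexify ∘ fun y => U y - m₀) (Fin.cons m.1 m.2)) := by
  rw [show (Fin.cons (-m).1 (-m).2 : Fin 4 → ℤ) = -(Fin.cons m.1 m.2) from ?_]
  · exact conjVec_mFourierCoeff_complexify (hU.sub (isSmooth_const m₀)).integrable _
  · rw [Prod.fst_neg, Prod.snd_neg, neg_cons]

/-- **The complexified momentum identity in terms of `V = U − m₀`**: with
`Vc = complexify ∘ V`, the identity `∂₀U = a (ν ΔₓU − (U·∇ₓ)U − G + F∘tail)` reads
`∂₀Vc = a (ν ΔₓVc − ∑ⱼ m₀ⱼ ∂_{j+1}Vc − ∑ⱼ (Vc)ⱼ ∂_{j+1}Vc − Gc + Fc∘tail)`. [folklore] -/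
theorem momentum_complexified (hU : IsSmooth U)
    (hE : ∀ y, Torus.partialDeriv 0 U y = a • (ν • (∑ i : Fin 3, Torus.partialDeriv (Fin.succ i) (Torus.partialDeriv (Fin.succ i) U) y) -
      (∑ j : Fin 3, (U y) j • Torus.partialDeriv (Fin.succ j) U y) - G y + F (Fin.tail y))) (y : UnitAddTorus (Fin 4)) :
    Torus.partialDeriv 0 (complexify ∘ fun z => U z - m₀) y =
      (a : ℂ) • ((ν : ℂ) • (∑ i : Fin 3, Torus.partialDeriv (Fin.succ i)
          (Torus.partialDeriv (Fin.succ i) (complexify ∘ fun z => U z - m₀)) y) -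
        (∑ j : Fin 3, ((m₀ j : ℝ) : ℂ) • Torus.partialDeriv (Fin.succ j) (complexify ∘ fun z => U z - m₀) y) -
        (∑ j : Fin 3, ((complexify ∘ fun z => U z - m₀) y) j •
          Torus.partialDeriv (Fin.succ j) (complexify ∘ fun z => U z - m₀) y) -
        complexify (G y) + complexify (F (Fin.tail y))) := by
  have hV : IsSmooth (fun z => U z - m₀) := hU.sub (isSmooth_const m₀)
  -- derivatives of `Vc` are complexified derivatives of `U`
  have hd1 : ∀ j z, Torus.partialDeriv j (complexify ∘ fun z => U z - m₀) z = complexify (Torus.partialDeriv j U z) := by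
    intro j z
    have h := partialDeriv_clm_comp hV complexify.toContinuousLinearMap j z
    simp only [LinearIsometry.coe_toContinuousLinearMap] at h
    rw [h, partialDeriv_sub_const]
  have hd1' : ∀ j, Torus.partialDeriv j (complexify ∘ fun z => U z - m₀) = complexify ∘ Torus.partialDeriv j U := by
    intro j; funext z; exact hd1 j z
  have hd2 : ∀ i j z, Torus.partialDeriv i (Torus.partialDeriv j (complexify ∘ fun z => U z - m₀)) z =
      complexify (Torus.partialDeriv i (Torus.partialDeriv j U) z) := by
    intro i j z
    rw [hd1' j]
    have h := partialDeriv_clm_comp (hU.partialDeriv j) complexify.toContinuousLinearMap i z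
    simpa only [LinearIsometry.coe_toContinuousLinearMap] using h
  -- the convective term: `U = m₀ + V`
  have hconv : (∑ j : Fin 3, (U y) j • complexify (Torus.partialDeriv (Fin.succ j) U y)) =
      (∑ j : Fin 3, (m₀ j) • complexify (Torus.partialDeriv (Fin.succ j) U y)) +
        ∑ j : Fin 3, ((complexify (U y) - complexify m₀) j) • complexify (Torus.partialDeriv (Fin.succ j) U y) := by
    rw [← Finset.sum_add_distrib]
    refine Finset.sum_congr rfl fun j _ => ?_
    rw [← map_sub, complexify_apply, PiLp.sub_apply, ← Complex.coe_smul, ← Complex.coe_smul (m₀ j), ← add_smul,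
      Complex.ofReal_sub, add_sub_cancel]
  rw [hd1 0 y, hE y]
  simp only [hd1, hd2, Function.comp_apply, map_smul, map_sub, map_add, map_sum, smul_sub, smul_add,
    Complex.coe_smul, hconv]
  abel

/-- Coefficients of a five-term linear combination (bookkeeping). [folklore] -/
theorem mFourierCoeff_lincomb {f₁ f₂ f₃ f₄ f₅ : UnitAddTorus (Fin 4) → EuclideanSpace ℂ (Fin 3)}
    (h₁ : Integrable f₁ volume) (h₂ : Integrable f₂ volume) (h₃ : Integrable f₃ volume) (h₄ : Integrable f₄ volume)
    (h₅ : Integrable f₅ volume) (c c' : ℂ) (K : Fin 4 → ℤ) :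
    mFourierCoeff (fun y => c • (c' • f₁ y - f₂ y - f₃ y - f₄ y + f₅ y)) K =
      c • (c' • mFourierCoeff f₁ K - mFourierCoeff f₂ K - mFourierCoeff f₃ K - mFourierCoeff f₄ K + mFourierCoeff f₅ K) := by
  have e : (fun y => c • (c' • f₁ y - f₂ y - f₃ y - f₄ y + f₅ y)) = c • (c' • f₁ - f₂ - f₃ - f₄ + f₅) := by
    funext y; simp
  rw [e, mFourierCoeff_const_smul, mFourierCoeff_add ((((h₁.smul c').sub h₂).sub h₃).sub h₄) h₅,
    mFourierCoeff_sub (((h₁.smul c').sub h₂).sub h₃) h₄, mFourierCoeff_sub ((h₁.smul c').sub h₂) h₃,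
    mFourierCoeff_sub (h₁.smul c') h₂, mFourierCoeff_const_smul]

/-- **Time-derivative coefficients**: `𝓕(complexify ∘ ∂₀U)(n,k) = (2πi n) û(n,k)`. [folklore] -/
theorem coeff_partialDeriv_zero (hU : IsSmooth U) (m : ℤ × (Fin 3 → ℤ)) :
    mFourierCoeff (complexify ∘ Torus.partialDeriv 0 U) (Fin.cons m.1 m.2) =
      (2 * Real.pi * Complex.I * (m.1 : ℂ)) • 𝐮[U, m₀] m := by
  have hV : IsSmooth (fun z => U z - m₀) := hU.sub (isSmooth_const m₀)
  have hVc : IsSmooth (complexify ∘ fun z => U z - m₀) := hV.comp_clm complexify.toContinuousLinearMap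
  have hd : Torus.partialDeriv 0 (complexify ∘ fun z => U z - m₀) = complexify ∘ Torus.partialDeriv 0 U := by
    funext z
    have h := partialDeriv_clm_comp hV complexify.toContinuousLinearMap 0 z
    simp only [LinearIsometry.coe_toContinuousLinearMap] at h
    rw [h, Function.comp_apply, partialDeriv_sub_const]
  rw [← hd, mFourierCoeff_partialDeriv_zero_cons hVc]

/-- **The projected lattice equation of the rolled-up momentum identity** (Iooss 1972, §2;
Kielhöfer 2012, (I.8.9)–(I.8.15), on the Fourier side): if
`∂₀U = a (ν ΔₓU − (U·∇ₓ)U − G + F∘tail)` on `T⁴` with `a ≠ 0`, `div_x U = 0`, curl-free slices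
of `G`, slice means `m₀` of `U` and a divergence-free force `F`, then for `k ≠ 0`
`(2πi a⁻¹ n + 4π²ν|k|² + 2πi m₀·k) û(n,k) + Π_k N(û,û)(n,k) = [n = 0] 𝓕F(k)`. [folklore] -/
theorem lattice_equation (hU : IsSmooth U) (hG : IsSmooth G) (hF : IsSmooth F) (hFdiv : IsDivFree F) (ha : a ≠ 0)
    (hE : ∀ y, Torus.partialDeriv 0 U y = a • (ν • (∑ i : Fin 3, Torus.partialDeriv (Fin.succ i) (Torus.partialDeriv (Fin.succ i) U) y) -
      (∑ j : Fin 3, (U y) j • Torus.partialDeriv (Fin.succ j) U y) - G y + F (Fin.tail y)))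
    (hdiv : ∀ y, ∑ i : Fin 3, Torus.partialDeriv (Fin.succ i) (fun z => U z i) y = 0)
    (hcurl : ∀ y (i j : Fin 3), Torus.partialDeriv (Fin.succ i) (fun z => G z j) y =
      Torus.partialDeriv (Fin.succ j) (fun z => G z i) y)
    (m : ℤ × (Fin 3 → ℤ)) (hm : m.2 ≠ 0) :
    (2 * Real.pi * Complex.I * ((a⁻¹ : ℝ) : ℂ) * (m.1 : ℂ) + ((4 * Real.pi ^ 2 * ν * freqNormSq m.2 : ℝ) : ℂ) +
        2 * Real.pi * Complex.I * (∑ jj : Fin 3, ((m₀ jj : ℝ) : ℂ) * ((m.2 jj : ℤ) : ℂ))) • 𝐮[U, m₀] m +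
      Torus.lerayCoeff m.2 (𝐍[𝐮[U, m₀], 𝐮[U, m₀]] m) =
      if m.1 = 0 then mFourierCoeff (complexify ∘ F) m.2 else 0 := by
  have hV : IsSmooth (fun z => U z - m₀) := hU.sub (isSmooth_const m₀)
  have hVc : IsSmooth (complexify ∘ fun z => U z - m₀) := hV.comp_clm complexify.toContinuousLinearMap
  have hGc : IsSmooth (complexify ∘ G) := hG.comp_clm complexify.toContinuousLinearMap
  have hFc : IsSmooth (complexify ∘ F) := hF.comp_clm complexify.toContinuousLinearMap
  -- the five fields
  set Vc : UnitAddTorus (Fin 4) → EuclideanSpace ℂ (Fin 3) := complexify ∘ fun z => U z - m₀ with hVc_def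
  set L : UnitAddTorus (Fin 4) → EuclideanSpace ℂ (Fin 3) :=
    fun y => ∑ i : Fin 3, Torus.partialDeriv (Fin.succ i) (Torus.partialDeriv (Fin.succ i) Vc) y with hL
  set D : UnitAddTorus (Fin 4) → EuclideanSpace ℂ (Fin 3) :=
    fun y => ∑ j : Fin 3, ((m₀ j : ℝ) : ℂ) • Torus.partialDeriv (Fin.succ j) Vc y with hD
  set T : UnitAddTorus (Fin 4) → EuclideanSpace ℂ (Fin 3) :=
    fun y => ∑ j : Fin 3, (Vc y) j • Torus.partialDeriv (Fin.succ j) Vc y with hT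
  set Fc : UnitAddTorus (Fin 4) → EuclideanSpace ℂ (Fin 3) := fun y => (complexify ∘ F) (Fin.tail y) with hFc_def
  have hLc : Continuous L := continuous_finsetSum _ fun i _ => ((hVc.partialDeriv _).partialDeriv _).continuous
  have hDc : Continuous D := continuous_finsetSum _ fun j _ => ((hVc.partialDeriv (Fin.succ j)).continuous.const_smul
    ((m₀ j : ℝ) : ℂ) :)
  have hTc : Continuous T :=
    continuous_finsetSum _ fun j _ => (isSmooth_apply hVc j).continuous.smul (hVc.partialDeriv _).continuous
  have hFcc : Continuous Fc := hFc.continuous.comp (continuous_pi fun _ => continuous_apply _)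
  -- the complexified identity and its coefficients at `K = (n, k)`
  have hEc : Torus.partialDeriv 0 Vc = fun y => (a : ℂ) • ((ν : ℂ) • L y - D y - T y - (complexify ∘ G) y + Fc y) :=
    funext fun y => momentum_complexified hU hE y
  have hcoef : mFourierCoeff (Torus.partialDeriv 0 Vc) (Fin.cons m.1 m.2) =
      mFourierCoeff (fun y => (a : ℂ) • ((ν : ℂ) • L y - D y - T y - (complexify ∘ G) y + Fc y)) (Fin.cons m.1 m.2) := by
    rw [hEc]
  rw [mFourierCoeff_partialDeriv_zero_cons hVc, mFourierCoeff_lincomb hLc.integrable_unitAddTorus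
    hDc.integrable_unitAddTorus hTc.integrable_unitAddTorus hGc.integrable hFcc.integrable_unitAddTorus] at hcoef
  -- the individual coefficients
  set v : EuclideanSpace ℂ (Fin 3) := mFourierCoeff Vc (Fin.cons m.1 m.2) with hv
  have cL : mFourierCoeff L (Fin.cons m.1 m.2) = (((-(4 * Real.pi ^ 2 * freqNormSq m.2)) : ℝ) : ℂ) • v :=
    mFourierCoeff_laplacianX_cons hVc m.1 m.2
  have cD : mFourierCoeff D (Fin.cons m.1 m.2) =
      (2 * Real.pi * Complex.I * (∑ jj : Fin 3, ((m₀ jj : ℝ) : ℂ) * ((m.2 jj : ℤ) : ℂ))) • v := by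
    have hint : ∀ j : Fin 3, Integrable (fun y => ((m₀ j : ℝ) : ℂ) • Torus.partialDeriv (Fin.succ j) Vc y) volume :=
      fun j => (((hVc.partialDeriv (Fin.succ j)).continuous.const_smul ((m₀ j : ℝ) : ℂ) :)).integrable_unitAddTorus
    rw [hD, mFourierCoeff_finset_sum Finset.univ (fun j _ => hint j)]
    have : ∀ j : Fin 3, mFourierCoeff (fun y => ((m₀ j : ℝ) : ℂ) • Torus.partialDeriv (Fin.succ j) Vc y) (Fin.cons m.1 m.2) =
        (((m₀ j : ℝ) : ℂ) * dsym j m.2) • v := by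
      intro j
      rw [show (fun y => ((m₀ j : ℝ) : ℂ) • Torus.partialDeriv (Fin.succ j) Vc y) =
          ((m₀ j : ℝ) : ℂ) • Torus.partialDeriv (Fin.succ j) Vc from rfl, mFourierCoeff_const_smul,
        mFourierCoeff_partialDeriv_succ_cons hVc, smul_smul]
    simp_rw [this, ← Finset.sum_smul]
    congr 1
    rw [Finset.mul_sum]
    refine Finset.sum_congr rfl fun j _ => ?_
    rw [dsym_apply]; ring
  have cT : mFourierCoeff T (Fin.cons m.1 m.2) = 𝐍[𝐮[U, m₀], 𝐮[U, m₀]] m := mFourierCoeff_transport_cons hVc hVc m.1 m.2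
  set N₀ : EuclideanSpace ℂ (Fin 3) := 𝐍[𝐮[U, m₀], 𝐮[U, m₀]] m with hN₀
  set Fn : EuclideanSpace ℂ (Fin 3) := (if m.1 = 0 then mFourierCoeff (complexify ∘ F) m.2 else 0) with hFn
  have cG : Torus.lerayCoeff m.2 (mFourierCoeff (complexify ∘ G) (Fin.cons m.1 m.2)) = 0 :=
    lerayCoeff_mFourierCoeff_eq_zero_of_curlFree hG hcurl m.1 hm
  have cF : mFourierCoeff Fc (Fin.cons m.1 m.2) = Fn := mFourierCoeff_comp_tail hFc.continuous m.1 m.2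
  -- the Leray multiplier as a linear map, and its values on the pieces
  let P : EuclideanSpace ℂ (Fin 3) →ₗ[ℂ] EuclideanSpace ℂ (Fin 3) :=
    { toFun := Torus.lerayCoeff m.2, map_add' := SteadyLattice.lerayCoeff_add' m.2,
      map_smul' := SteadyLattice.lerayCoeff_smul' m.2 }
  have hP : ∀ w, P w = Torus.lerayCoeff m.2 w := fun w => rfl
  have Pv : Torus.lerayCoeff m.2 v = v := SteadyLattice.lerayCoeff_of_kdot_eq_zero hm (kdot_coeff_sub_mean hU hdiv m)
  have PF : Torus.lerayCoeff m.2 Fn = Fn := by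
    rw [hFn]
    split_ifs
    · exact SteadyLattice.lerayCoeff_of_kdot_eq_zero hm (hFdiv.sum_mul_mFourierCoeff_eq_zero hF m.2)
    · exact SteadyLattice.lerayCoeff_zero_vec m.2
  rw [cL, cD, cT, cF] at hcoef
  have h := congrArg P hcoef
  simp only [map_smul, map_sub, map_add] at h
  simp only [hP, Pv, cG, PF, sub_zero] at h
  set N : EuclideanSpace ℂ (Fin 3) := Torus.lerayCoeff m.2 N₀ with hN
  -- scalar bookkeeping, coordinatewise
  have ha' : (a : ℂ) ≠ 0 := by exact_mod_cast ha
  have hb : (a : ℂ) * (a : ℂ)⁻¹ = 1 := mul_inv_cancel₀ ha'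
  ext i
  have hi := congrArg (fun w : EuclideanSpace ℂ (Fin 3) => w i) h
  simp only [PiLp.add_apply, PiLp.sub_apply, PiLp.smul_apply, smul_eq_mul] at hi ⊢
  push_cast at hi ⊢
  linear_combination (a : ℂ)⁻¹ * hi +
    ((ν : ℂ) * (-(4 * (Real.pi : ℂ) ^ 2 * (freqNormSq m.2 : ℂ)) * v i) -
      2 * Real.pi * Complex.I * (∑ jj : Fin 3, ((m₀ jj : ℝ) : ℂ) * ((m.2 jj : ℤ) : ℂ)) * v i - N i + Fn i) * hb

end RolledUp



/-! ## §C⁵ The classical time-periodic orbit -/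

section Orbit

variable {ν τ : ℝ} {f : UnitAddTorus (Fin 3) → EuclideanSpace ℝ (Fin 3)}
  {u : ℝ → UnitAddTorus (Fin 3) → EuclideanSpace ℝ (Fin 3)} {p : ℝ → UnitAddTorus (Fin 3) → ℝ}

/-- Components of smooth real fields on `T⁴` are smooth. [folklore] -/
theorem isSmooth_apply_real {U : UnitAddTorus (Fin 4) → EuclideanSpace ℝ (Fin 3)} (hU : IsSmooth U) (j : Fin 3) :
    IsSmooth (fun y => (U y) j) :=
  hU.comp_clm (EuclideanSpace.proj j : EuclideanSpace ℝ (Fin 3) →L[ℝ] ℝ)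

/-- **The force of a classical solution with smooth data is smooth** (it is
`∂ₜu + (u·∇)u − νΔu + ∇p` at `t = 0`). [folklore] -/
theorem isSmooth_force (hsol : Torus.IsClassicalNSSolutionOn univ ν (fun _ => f) u p) : IsSmooth f := by
  have hu := hsol.smooth_velocity
  have hu0 : IsSmooth (u 0) := hu.isSmooth_slice (mem_univ 0)
  have hp0 : IsSmooth (p 0) := hsol.smooth_pressure.isSmooth_slice (mem_univ 0)
  have hdt : IsSmooth (timeDerivWithin univ u 0) := hu.isSmooth_timeDerivWithin uniqueDiffOn_univ (mem_univ 0)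
  have hf : f = fun x => timeDerivWithin univ u 0 x + Torus.convect (u 0) (u 0) x - ν • Torus.laplacian (u 0) x +
      Torus.gradient (p 0) x := by
    funext x
    have h := hsol.momentum 0 (mem_univ 0) x
    rw [h]; abel
  rw [hf]
  exact ((hdt.add (hu0.convect hu0)).sub (hu0.laplacian.smul ν)).add hp0.gradient

/-- **Mean conservation**: with a mean-zero force the spatial mean of the velocity is constant in
time (`d/dt ∫u = ∫f = 0`, `TorusClassicalNSGluing`). [folklore] -/
theorem orbit_mean (hsol : Torus.IsClassicalNSSolutionOn univ ν (fun _ => f) u p) (hf0 : HasZeroMean f) (t : ℝ) :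
    (∫ x, u t x) = ∫ x, u 0 x := by
  have hd : ∀ s : ℝ, HasDerivAt (fun s => ∫ x, u s x) 0 s := by
    intro s
    have h := hsol.hasDerivWithinAt_integral_velocity convex_univ (mem_univ s)
    rw [show (∫ x, (fun _ : ℝ => f) s x) = 0 from hf0] at h
    exact h.hasDerivAt univ_mem
  exact is_const_of_deriv_eq_zero (fun s => (hd s).differentiableAt) (fun s => (hd s).deriv) t 0

/-- The rolled-up velocity is smooth on `T⁴`. [folklore] -/
theorem orbit_isSmooth (hsol : Torus.IsClassicalNSSolutionOn univ ν (fun _ => f) u p) (hper : Function.Periodic u τ) :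
    IsSmooth (timeRoll τ u) :=
  isSmooth_timeRoll hsol.smooth_velocity hper

/-- **The rolled-up pressure gradient is the slice gradient**:
`G(↑s, x) = ∇p(τs)(x)` (the momentum equation at `t = τ s`). [folklore] -/
theorem orbit_G_cons (hsol : Torus.IsClassicalNSSolutionOn univ ν (fun _ => f) u p) (hper : Function.Periodic u τ)
    (hτ : 0 < τ) (s : ℝ) (x : UnitAddTorus (Fin 3)) :
    𝐆[ν, τ, f, u] (Fin.cons ((s : ℝ) : UnitAddCircle) x) = Torus.gradient (p (τ * s)) x := by
  have hU := orbit_isSmooth hsol hper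
  have hsl : timeSlice (timeRoll τ u) ((s : ℝ) : UnitAddCircle) = u (τ * s) := timeSlice_timeRoll hper s
  have hmom := hsol.momentum (τ * s) (mem_univ _) x
  simp only
  rw [← laplacian_timeSlice hU, ← convect_timeSlice hU, Fin.tail_cons, partialDeriv_zero_timeRoll hsol.smooth_velocity hper,
    smul_smul, inv_mul_cancel₀ hτ.ne', one_smul, hsl]
  have h' : Torus.gradient (p (τ * s)) x = ν • Torus.laplacian (u (τ * s)) x -
      (timeDerivWithin univ u (τ * s) x + Torus.convect (u (τ * s)) (u (τ * s)) x) + f x := by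
    rw [hmom]; abel
  rw [h']; abel

/-- Finite sums of smooth functions are smooth (real normed spaces). [folklore] -/
theorem isSmooth_fun_finsetSum {F' : Type*} [NormedAddCommGroup F'] [NormedSpace ℝ F'] {ι : Type*} (T : Finset ι)
    {g : ι → UnitAddTorus (Fin 4) → F'} (h : ∀ i ∈ T, IsSmooth (g i)) : IsSmooth (fun y => ∑ i ∈ T, g i y) := by
  classical
  induction T using Finset.induction_on with
  | empty => simp only [Finset.sum_empty]; exact isSmooth_const (0 : F')
  | insert i T hi ih =>
      simp only [Finset.sum_insert hi]
      exact (h i (Finset.mem_insert_self i T)).add (ih fun j hj => h j (Finset.mem_insert_of_mem hj))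

/-- The rolled-up pressure gradient is smooth on `T⁴`. [folklore] -/
theorem orbit_isSmooth_G (hsol : Torus.IsClassicalNSSolutionOn univ ν (fun _ => f) u p) (hper : Function.Periodic u τ) :
    IsSmooth 𝐆[ν, τ, f, u] := by
  have hU := orbit_isSmooth hsol hper
  have hUj : ∀ j, IsSmooth (fun y => (timeRoll τ u y) j) := isSmooth_apply_real hU
  have hL : IsSmooth (fun y => ∑ i : Fin 3,
      Torus.partialDeriv (Fin.succ i) (Torus.partialDeriv (Fin.succ i) (timeRoll τ u)) y) :=
    isSmooth_fun_finsetSum _ fun i _ => (hU.partialDeriv _).partialDeriv _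
  have hC : IsSmooth (fun y => ∑ j : Fin 3, (timeRoll τ u y) j • Torus.partialDeriv (Fin.succ j) (timeRoll τ u) y) :=
    isSmooth_fun_finsetSum _ fun j _ => (hUj j).smul' (hU.partialDeriv _)
  have hFt : IsSmooth (fun y : UnitAddTorus (Fin 4) => f (Fin.tail y)) := by
    have : (fun y : UnitAddTorus (Fin 4) => f (Fin.tail y)) = timeRoll τ (fun _ : ℝ => f) := rfl
    rw [this]
    exact isSmooth_timeRoll (isSmoothSpaceTimeOn_const (isSmooth_force hsol) univ) (fun t => rfl)
  have hT : IsSmooth (Torus.partialDeriv 0 (timeRoll τ u)) := hU.partialDeriv 0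
  exact (((hL.smul ν).sub hC).add hFt).sub (hT.smul τ⁻¹)

/-- **The rolled-up momentum identity** `∂₀U = τ (ν ΔₓU − (U·∇ₓ)U − G + f∘tail)` (by the
definition of `G`). [folklore] -/
theorem orbit_E (hτ : 0 < τ) (y : UnitAddTorus (Fin 4)) :
    Torus.partialDeriv 0 (timeRoll τ u) y =
      τ • (ν • (∑ i : Fin 3, Torus.partialDeriv (Fin.succ i) (Torus.partialDeriv (Fin.succ i) (timeRoll τ u)) y) -
        (∑ j : Fin 3, ((timeRoll τ u) y) j • Torus.partialDeriv (Fin.succ j) (timeRoll τ u) y) -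
        𝐆[ν, τ, f, u] y + f (Fin.tail y)) := by
  have key : ∀ L C F T : EuclideanSpace ℝ (Fin 3), T = τ • (ν • L - C - (ν • L - C + F - τ⁻¹ • T) + F) := by
    intro L C F T
    rw [show ν • L - C - (ν • L - C + F - τ⁻¹ • T) + F = τ⁻¹ • T by abel, smul_smul, mul_inv_cancel₀ hτ.ne', one_smul]
  exact key _ _ _ _

/-- The rolled-up velocity is divergence free in the spatial variables. [folklore] -/
theorem orbit_div (hsol : Torus.IsClassicalNSSolutionOn univ ν (fun _ => f) u p) (hper : Function.Periodic u τ)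
    (y : UnitAddTorus (Fin 4)) :
    ∑ i : Fin 3, Torus.partialDeriv (Fin.succ i) (fun z => timeRoll τ u z i) y = 0 := by
  obtain ⟨s, x, rfl⟩ := exists_eq_cons y
  rw [← divergence_timeSlice, timeSlice_timeRoll hper]
  exact hsol.divFree (τ * s) (mem_univ _) x

/-- The rolled-up pressure gradient has curl-free slices. [folklore] -/
theorem orbit_curl (hsol : Torus.IsClassicalNSSolutionOn univ ν (fun _ => f) u p) (hper : Function.Periodic u τ)
    (hτ : 0 < τ) (y : UnitAddTorus (Fin 4)) (i j : Fin 3) :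
    Torus.partialDeriv (Fin.succ i) (fun z => 𝐆[ν, τ, f, u] z j) y =
      Torus.partialDeriv (Fin.succ j) (fun z => 𝐆[ν, τ, f, u] z i) y := by
  obtain ⟨s, x, rfl⟩ := exists_eq_cons y
  have hp : IsSmooth (p (τ * s)) := hsol.smooth_pressure.isSmooth_slice (mem_univ _)
  have hsl : ∀ l : Fin 3, timeSlice (fun z => 𝐆[ν, τ, f, u] z l) ((s : ℝ) : UnitAddCircle) =
      Torus.partialDeriv l (p (τ * s)) := by
    intro l
    funext x'
    rw [timeSlice_apply, orbit_G_cons hsol hper hτ s x', gradient_apply_eq' (hp.isContDiff (by simp))]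
  rw [partialDeriv_succ_cons, partialDeriv_succ_cons, hsl, hsl]
  exact Torus.partialDeriv_comm hp i j x

/-- The slices of the rolled-up velocity have the constant mean `∫ u(0)`. [folklore] -/
theorem orbit_sliceMean (hsol : Torus.IsClassicalNSSolutionOn univ ν (fun _ => f) u p) (hper : Function.Periodic u τ)
    (hf0 : HasZeroMean f) (c : UnitAddCircle) :
    (∫ x, timeSlice (timeRoll τ u) c x) = ∫ x, u 0 x := by
  obtain ⟨s, rfl⟩ := QuotientAddGroup.mk_surjective c
  rw [show (QuotientAddGroup.mk s : UnitAddCircle) = ((s : ℝ) : UnitAddCircle) from rfl, timeSlice_timeRoll hper]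
  exact orbit_mean hsol hf0 _

/-- **Lattice data of the orbit, (i)**: zero spatial modes vanish. [folklore] -/
theorem orbit_zero_modes (hsol : Torus.IsClassicalNSSolutionOn univ ν (fun _ => f) u p) (hper : Function.Periodic u τ)
    (hf0 : HasZeroMean f) (n : ℤ) :
    𝐮[timeRoll τ u, ∫ x, u 0 x] ((n, 0) : ℤ × (Fin 3 → ℤ)) = 0 :=
  coeff_sub_mean_cons_zero (orbit_isSmooth hsol hper) (orbit_sliceMean hsol hper hf0) n

/-- **Lattice data of the orbit, (ii)**: transversality. [folklore] -/
theorem orbit_transversal (hsol : Torus.IsClassicalNSSolutionOn univ ν (fun _ => f) u p) (hper : Function.Periodic u τ)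
    (m : ℤ × (Fin 3 → ℤ)) :
    (∑ jj : Fin 3, ((m.2 jj : ℤ) : ℂ) * (𝐮[timeRoll τ u, ∫ x, u 0 x] m) jj) = 0 :=
  kdot_coeff_sub_mean (orbit_isSmooth hsol hper) (orbit_div hsol hper) m

/-- **Lattice data of the orbit, (iii)**: conjugate symmetry. [folklore] -/
theorem orbit_conj (hsol : Torus.IsClassicalNSSolutionOn univ ν (fun _ => f) u p) (hper : Function.Periodic u τ)
    (m : ℤ × (Fin 3 → ℤ)) :
    𝐮[timeRoll τ u, ∫ x, u 0 x] (-m) = conjVec (𝐮[timeRoll τ u, ∫ x, u 0 x] m) :=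
  coeff_sub_mean_neg (orbit_isSmooth hsol hper) m

/-- **Lattice data of the orbit, (iv)**: rapid decay of the coefficient family on `ℤ⁴`. [folklore] -/
theorem orbit_rapidDecay (hsol : Torus.IsClassicalNSSolutionOn univ ν (fun _ => f) u p) (hper : Function.Periodic u τ) :
    RapidDecay (mFourierCoeff (complexify ∘ fun y => timeRoll τ u y - ∫ x, u 0 x)) := by
  have hV : IsSmooth (fun y => timeRoll τ u y - ∫ x, u 0 x) := (orbit_isSmooth hsol hper).sub (isSmooth_const _)
  have hVc : IsSmooth (complexify ∘ fun y => timeRoll τ u y - ∫ x, u 0 x) := hV.comp_clm complexify.toContinuousLinearMap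
  exact hVc.rapidDecay_mFourierCoeff

/-- **Lattice data of the orbit, (v): the projected lattice equation**
`(2πi τ⁻¹ n + 4π²ν|k|² + 2πi m₀·k) û(n,k) + Π_k N(û,û)(n,k) = [n = 0] f̂(k)` for `k ≠ 0`, for a
classical `τ`-periodic solution with a time-independent divergence-free mean-zero force
(Iooss 1972, §2; Kielhöfer 2012, (I.8.9)–(I.8.15)). [folklore] -/
theorem orbit_equation (hsol : Torus.IsClassicalNSSolutionOn univ ν (fun _ => f) u p) (hper : Function.Periodic u τ)
    (hτ : 0 < τ) (hfd : IsDivFree f) (m : ℤ × (Fin 3 → ℤ)) (hm : m.2 ≠ 0) :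
    (2 * Real.pi * Complex.I * ((τ⁻¹ : ℝ) : ℂ) * (m.1 : ℂ) + ((4 * Real.pi ^ 2 * ν * freqNormSq m.2 : ℝ) : ℂ) +
        2 * Real.pi * Complex.I * (∑ jj : Fin 3, (((∫ x, u 0 x) jj : ℝ) : ℂ) * ((m.2 jj : ℤ) : ℂ))) •
        𝐮[timeRoll τ u, ∫ x, u 0 x] m +
      Torus.lerayCoeff m.2 (𝐍[𝐮[timeRoll τ u, ∫ x, u 0 x], 𝐮[timeRoll τ u, ∫ x, u 0 x]] m) =
      if m.1 = 0 then mFourierCoeff (complexify ∘ f) m.2 else 0 :=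
  lattice_equation (orbit_isSmooth hsol hper) (orbit_isSmooth_G hsol hper) (isSmooth_force hsol) hfd hτ.ne'
    (orbit_E hτ) (orbit_div hsol hper) (orbit_curl hsol hper hτ) m hm

end Orbit

end TimePeriodicLattice

end Literature.Analysis.FluidPDE
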